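import Mathlib
import Summits.NavierStokesRegularity.NavierStokesRegularity.Theorems.OrthantWakeOrthantBreakOfWake
import Literature.Analysis.FluidPDE.Tao2016AveragedNS.WeightedLatticeFlows
import HarnessLib

/-!
# `OrthantWake.OrthantHopWake` — support: bond-flux positivity of orthant tables and the TAIL FLUX
BUDGET of the viscous lattice (helper file for item stmt-NavierStokesRegularity-24639; `--supports`)

The crux `OrthantHopWake` (per-hop super-critical ratchet of the tail energies
`T_{n+1}(t) ≤ (1+ε₀)^{-(1+η)} max_{u≤t} T_n(u)` for orthant tables) is planned in two layers
(route OrthantWake, TWO-LAYER PLAN): `TailFluxBudget` — the tail energy above shell `n` is fed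
ONLY through the bond `n → n+1`, by a NON-NEGATIVE flux, dissipation dropped — and the lever
`FluxCappedByResidue` (open). This file proves the first layer and the structural facts it uses,
for the objects of the route decl verbatim (families `X : Fin 4 → ℤ → ℝ → ℝ`, Tao's `quadTerm`,
the cubic bond flux `botSum` of `TaoCascadeNoLow`):

* `orthantHop_feed_nonneg` — for a Kamke (orthant) table every inter-shell FEED FORM
  `w ↦ Σ_{i₁i₂} α_{i₁i₂i,(0,0,1)} w_{i₁} w_{i₂}` is non-negative on ALL of `ℝ⁴` (sign-blind feeds:
  the Kamke condition at shell `1` with an arbitrary datum shell);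
* `orthantHop_botSum_nonneg` — hence the bond flux `Π_n = botSum ε₀ α X n` through `n → n+1`
  (`n ≥ 0`) is `≥ 0` whenever the modes on shells `≥ 1` are `≥ 0`;
* `orthantHop_tailFluxBudget` — for a cancelling table and a regular `ν`-viscous solution on
  `[0,s]` with the (4.5) weight bound: `T_{n+1}(t) − T_{n+1}(t₀) ≤ ∫_{t₀}^{t} Π_n` for
  `0 ≤ t₀ ≤ t ≤ s` (finite partial tails have derivative `Π_n + topSum(n+L) − dissipation` by the
  telescoping `sum_range_sum_quadTerm_mul`; the escaping flux `topSum(n+L)` is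
  `O((1+ε₀)^{-20(n+L)})`; pass to the limit);
* `orthantHop_tail_le_integral_flux` — with the one-shell datum at shell `0`:
  `T_{n+1}(t) ≤ ∫₀ᵗ Π_n`, the layer-2 statement `TailFluxBudget` of the route plan.

HONEST FRAMING: elementary real analysis of Tao-type MODEL lattice ODEs; the crux itself is NOT
proved here; nothing in this file bears on Navier–Stokes regularity.
-/

noncomputable section

-- the sub-problem namespace `NavierStokesRegularity.NavierStokesRegularity` is the tree's layout (D-0017)
set_option linter.dupNamespace false

namespace Summit.NavierStokesRegularity.NavierStokesRegularity.Theorems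

open Set Filter MeasureTheory intervalIntegral
open scoped Topology
open Literature.Analysis.FluidPDE.TaoCascade

/-! ## Orthant structure: sign-blind feeds and non-negative bond flux -/

/-- **Feeds of an orthant table are non-negative forms.** If the table `α` satisfies the Kamke
(quasi-positivity) condition of the route, then for every output mode `i` the inter-shell feed
form `Σ_{i₁,i₂} α_{i₁ i₂ i,(0,0,1)} w_{i₁} w_{i₂}` is `≥ 0` for EVERY real vector `w` (test the
Kamke condition at shell `1` with the datum shell carrying `w`). [this file] -/
theorem orthantHop_feed_nonneg {α : Fin 4 → Fin 4 → Fin 4 → ℤ × ℤ × ℤ → ℝ}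
    (hK : ∀ (Y : Fin 4 → ℤ → ℝ → ℝ) (τ : ℝ), (∀ (j : Fin 4) (k : ℤ), 1 ≤ k → 0 ≤ Y j k τ) →
      ∀ δ : ℝ, 0 < δ → ∀ (i : Fin 4) (n : ℤ), 1 ≤ n → Y i n τ = 0 → 0 ≤ quadTerm δ α Y i n τ)
    (w : Fin 4 → ℝ) (i : Fin 4) :
    0 ≤ ∑ i₁ : Fin 4, ∑ i₂ : Fin 4, α i₁ i₂ i (0, 0, 1) * (w i₁ * w i₂) := by
  set Y : Fin 4 → ℤ → ℝ → ℝ := fun j l _ => if l = 0 then w j else 0 with hY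
  have hYnn : ∀ (j : Fin 4) (k : ℤ), 1 ≤ k → 0 ≤ Y j k 0 := by
    intro j k hk
    simp [hY, show k ≠ 0 by omega]
  have hY1 : Y i 1 0 = 0 := by simp [hY]
  have h := hK Y 0 hYnn 1 one_pos i 1 le_rfl hY1
  rw [quadTerm_four_shifts] at h
  simpa [hY] using h

/-- **The bond flux of an orthant table is non-negative on the cone.** For a Kamke table, a
configuration that is `≥ 0` on shells `≥ 1` at time `t`, and a bond `n → n+1` with `n ≥ 0`, the
cubic energy flux `Π_n = botSum ε₀ α X n t = (1+ε₀)^{5n/2} Σ α_{(0,0,1)} X_n X_n X_{n+1}` is `≥ 0`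
(each receiving mode `X_{i,n+1} ≥ 0` is fed by a non-negative form of the shell-`n` vector,
whatever its signs). [this file] -/
theorem orthantHop_botSum_nonneg {ε₀ : ℝ} (hε : 0 ≤ 1 + ε₀)
    {α : Fin 4 → Fin 4 → Fin 4 → ℤ × ℤ × ℤ → ℝ}
    (hK : ∀ (Y : Fin 4 → ℤ → ℝ → ℝ) (τ : ℝ), (∀ (j : Fin 4) (k : ℤ), 1 ≤ k → 0 ≤ Y j k τ) →
      ∀ δ : ℝ, 0 < δ → ∀ (i : Fin 4) (n : ℤ), 1 ≤ n → Y i n τ = 0 → 0 ≤ quadTerm δ α Y i n τ)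
    {X : Fin 4 → ℤ → ℝ → ℝ} {t : ℝ} {n : ℤ} (hn : 0 ≤ n)
    (hX : ∀ (i : Fin 4) (k : ℤ), 1 ≤ k → 0 ≤ X i k t) :
    0 ≤ botSum ε₀ α X n t := by
  have key : ∀ i₃ : Fin 4, 0 ≤ ∑ i₁ : Fin 4, ∑ i₂ : Fin 4, α i₁ i₂ i₃ (0, 0, 1) *
      (1 + ε₀) ^ ((5 : ℝ) * n / 2) * (X i₁ n t * X i₂ n t * X i₃ (n + 1) t) := by
    intro i₃
    have hF := orthantHop_feed_nonneg hK (fun j => X j n t) i₃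
    have hc : 0 ≤ (1 + ε₀) ^ ((5 : ℝ) * n / 2) * X i₃ (n + 1) t :=
      mul_nonneg (Real.rpow_nonneg hε _) (hX i₃ (n + 1) (by omega))
    have heq : ∑ i₁ : Fin 4, ∑ i₂ : Fin 4, α i₁ i₂ i₃ (0, 0, 1) *
        (1 + ε₀) ^ ((5 : ℝ) * n / 2) * (X i₁ n t * X i₂ n t * X i₃ (n + 1) t) =
        ((1 + ε₀) ^ ((5 : ℝ) * n / 2) * X i₃ (n + 1) t) *
          ∑ i₁ : Fin 4, ∑ i₂ : Fin 4, α i₁ i₂ i₃ (0, 0, 1) * (X i₁ n t * X i₂ n t) := by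
      rw [Finset.mul_sum]
      refine Finset.sum_congr rfl fun i₁ _ => ?_
      rw [Finset.mul_sum]
      refine Finset.sum_congr rfl fun i₂ _ => ?_
      ring
    rw [heq]
    exact mul_nonneg hc hF
  have hcomm : botSum ε₀ α X n t = ∑ i₃ : Fin 4, ∑ i₁ : Fin 4, ∑ i₂ : Fin 4,
      α i₁ i₂ i₃ (0, 0, 1) * (1 + ε₀) ^ ((5 : ℝ) * n / 2) *
        (X i₁ n t * X i₂ n t * X i₃ (n + 1) t) := by
    unfold botSum
    calc ∑ i₁ : Fin 4, ∑ i₂ : Fin 4, ∑ i₃ : Fin 4, α i₁ i₂ i₃ (0, 0, 1) *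
          (1 + ε₀) ^ ((5 : ℝ) * n / 2) * (X i₁ n t * X i₂ n t * X i₃ (n + 1) t)
        = ∑ i₁ : Fin 4, ∑ i₃ : Fin 4, ∑ i₂ : Fin 4, α i₁ i₂ i₃ (0, 0, 1) *
          (1 + ε₀) ^ ((5 : ℝ) * n / 2) * (X i₁ n t * X i₂ n t * X i₃ (n + 1) t) :=
          Finset.sum_congr rfl fun i₁ _ => Finset.sum_comm
      _ = _ := Finset.sum_comm
  rw [hcomm]
  exact Finset.sum_nonneg fun i₃ _ => key i₃

/-! ## The tail flux budget -/

/-- **TAIL FLUX BUDGET (layer-2 `TailFluxBudget` of the route plan, two-time form).** For a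
cancelling table (Tao 2016 (4.3)) and a regular solution of the `ν`-viscous lattice on `[0,s]`
(continuous modes, (4.5) weight bound), the tail energy above shell `n`,
`T_{n+1}(u) = Σ_j Σ_i ½ X_{i,n+1+j}(u)²`, grows between two times `0 ≤ t₀ ≤ t ≤ s` by at most the
time integral of the bond flux: `T_{n+1}(t) − T_{n+1}(t₀) ≤ ∫_{t₀}^{t} Π_n(u) du`,
`Π_n = botSum ε₀ α X n` (the dissipation only helps; no sign condition on the table or on `X`
is needed for this inequality). [this file] -/
theorem orthantHop_tailFluxBudget {ε₀ ν s M : ℝ} (hε : 0 < ε₀) (hν : 0 < ν)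
    {α : Fin 4 → Fin 4 → Fin 4 → ℤ × ℤ × ℤ → ℝ} (hc : IsCancellingCoeff α)
    {X : Fin 4 → ℤ → ℝ → ℝ}
    (hM : ∀ (t : ℝ) (i : Fin 4) (k : ℤ), (1 + (1 + ε₀) ^ ((10 : ℝ) * k)) * |X i k t| ≤ M)
    (hcont : ∀ (i : Fin 4) (k : ℤ), Continuous (X i k))
    (hder : ∀ (i : Fin 4) (k : ℤ), ∀ t ∈ Icc (0 : ℝ) s, HasDerivWithinAt (X i k)
      (quadTerm ε₀ α X i k t - ν * (1 + ε₀) ^ ((2 : ℝ) * k) * X i k t) (Icc (0 : ℝ) s) t)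
    (n : ℕ) {t₀ t : ℝ} (ht₀ : 0 ≤ t₀) (ht₀t : t₀ ≤ t) (hts : t ≤ s) :
    (∑' j : ℕ, ∑ i : Fin 4, (1 / 2 : ℝ) * X i ((n + 1 : ℕ) + (j : ℤ)) t ^ 2) -
        (∑' j : ℕ, ∑ i : Fin 4, (1 / 2 : ℝ) * X i ((n + 1 : ℕ) + (j : ℤ)) t₀ ^ 2) ≤
      ∫ u in t₀..t, botSum ε₀ α X n u := by
  have h0 : (0 : ℝ) < 1 + ε₀ := by linarith
  have h1 : (1 : ℝ) ≤ 1 + ε₀ := by linarith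
  have hM0 : 0 ≤ M :=
    le_trans (mul_nonneg (add_nonneg zero_le_one (Real.rpow_nonneg h0.le _)) (abs_nonneg _))
      (hM t 0 0)
  set q : ℝ := ((1 + ε₀) ^ (10 : ℝ))⁻¹ with hq
  have hq10 : 0 < (1 + ε₀) ^ (10 : ℝ) := Real.rpow_pos_of_pos h0 _
  have hq0 : 0 ≤ q := inv_nonneg.2 hq10.le
  have hq1 : q < 1 := inv_lt_one_of_one_lt₀ (Real.one_lt_rpow (by linarith) (by norm_num))
  -- the viscous coefficients, as a function of the shell
  set c : ℤ → ℝ := fun K => ν * (1 + ε₀) ^ ((2 : ℝ) * K) with hcdef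
  have hc0 : ∀ K : ℤ, 0 ≤ c K := fun K => mul_nonneg hν.le (Real.rpow_nonneg h0.le _)
  have hder' : ∀ (i : Fin 4) (K : ℤ), ∀ u ∈ Icc (0 : ℝ) s, HasDerivWithinAt (X i K)
      (quadTerm ε₀ α X i K u - c K * X i K u) (Icc (0 : ℝ) s) u := fun i K u hu => hder i K u hu
  -- continuity of the bond flux
  have hPic : Continuous fun u => botSum ε₀ α X n u := by
    unfold botSum
    fun_prop
  -- the base shell of the tail
  set N : ℤ := ((n + 1 : ℕ) : ℤ) with hN
  -- partial tails over the shells `N, …, N+L-1` and their derivatives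
  set E : ℕ → ℝ → ℝ := fun L u =>
    ∑ k ∈ Finset.range L, ∑ i : Fin 4, (1 / 2 : ℝ) * X i (N + (k : ℤ)) u ^ 2 with hE
  set D : ℕ → ℝ → ℝ := fun L u => ∑ k ∈ Finset.range L, ∑ i : Fin 4,
    X i (N + (k : ℤ)) u * (quadTerm ε₀ α X i (N + (k : ℤ)) u - c (N + (k : ℤ)) * X i (N + (k : ℤ)) u)
    with hD
  have hderE : ∀ (L : ℕ), ∀ u ∈ Icc (0 : ℝ) s, HasDerivWithinAt (E L) (D L u) (Icc 0 s) u := by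
    intro L u hu
    simp only [hE, hD]
    refine HasDerivWithinAt.fun_sum fun k _ => HasDerivWithinAt.fun_sum fun i _ => ?_
    have h := ((hder' i (N + (k : ℤ)) u hu).pow 2).const_mul (1 / 2 : ℝ)
    refine h.congr_deriv ?_
    rw [show (2 : ℕ) - 1 = 1 from rfl, pow_one]
    push_cast
    ring
  -- the derivative: bond flux in, escaping flux at the top, minus dissipation
  set δ : ℕ → ℝ := fun L => coeffAbs α * M ^ 3 * (q ^ 2) ^ n * (q ^ 2) ^ L with hδ
  have hDle : ∀ (L : ℕ) (u : ℝ), D L u ≤ botSum ε₀ α X n u + δ L := by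
    intro L u
    have hstep1 : D L u ≤ ∑ k ∈ Finset.range L, ∑ i : Fin 4,
        quadTerm ε₀ α X i (N + k) u * X i (N + k) u := by
      simp only [hD]
      refine Finset.sum_le_sum fun k _ => Finset.sum_le_sum fun i _ => ?_
      have hν' : 0 ≤ c (N + (k : ℤ)) * X i (N + (k : ℤ)) u ^ 2 :=
        mul_nonneg (hc0 _) (sq_nonneg _)
      nlinarith [hν']
    rw [sum_range_sum_quadTerm_mul ε₀ hc X N L u] at hstep1
    have hN1 : N - 1 = (n : ℤ) := by simp only [hN]; push_cast; ring
    have hidx : N + (L : ℤ) - 1 = ((n + L : ℕ) : ℤ) := by simp only [hN]; push_cast; ring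
    rw [hN1, hidx] at hstep1
    have hbot := botSum_eq_neg_topSum ε₀ hc X (n : ℤ) u
    have hXb : ∀ i : Fin 4, |X i ((n + L : ℕ) : ℤ) u| ≤ M * q ^ (n + L) ∧
        |X i (((n + L : ℕ) : ℤ) + 1) u| ≤ M * q ^ (n + L) :=
      fun i => ⟨orthantBreak_abs_le hε (by omega) (hM u i _),
        orthantBreak_abs_le hε (by omega) (hM u i _)⟩
    have htop := abs_topSum_le ε₀ h0 α X ((n + L : ℕ) : ℤ) u
      (mul_nonneg hM0 (pow_nonneg hq0 (n + L))) hXb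
    have hgain : (1 + ε₀) ^ ((5 : ℝ) * (((n + L : ℕ) : ℤ) : ℝ) / 2) ≤
        ((1 + ε₀) ^ (10 : ℝ)) ^ (n + L) := by
      rw [← Real.rpow_natCast, ← Real.rpow_mul h0.le]
      push_cast
      exact Real.rpow_le_rpow_of_exponent_le h1
        (by linarith [(Nat.cast_nonneg n : (0 : ℝ) ≤ n), (Nat.cast_nonneg L : (0 : ℝ) ≤ L)])
    have hcA := coeffAbs_nonneg α
    have hPL : ((1 + ε₀) ^ (10 : ℝ)) ^ (n + L) * q ^ (n + L) = 1 := by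
      rw [← mul_pow, hq, mul_inv_cancel₀ hq10.ne', one_pow]
    have htop' : topSum ε₀ α X ((n + L : ℕ) : ℤ) u ≤ δ L :=
      calc topSum ε₀ α X ((n + L : ℕ) : ℤ) u ≤ |topSum ε₀ α X ((n + L : ℕ) : ℤ) u| := le_abs_self _
        _ ≤ (1 + ε₀) ^ ((5 : ℝ) * (((n + L : ℕ) : ℤ) : ℝ) / 2) * (M * q ^ (n + L)) ^ 3 *
              coeffAbs α := htop
        _ ≤ ((1 + ε₀) ^ (10 : ℝ)) ^ (n + L) * (M * q ^ (n + L)) ^ 3 * coeffAbs α :=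
            mul_le_mul_of_nonneg_right
              (mul_le_mul_of_nonneg_right hgain
                (pow_nonneg (mul_nonneg hM0 (pow_nonneg hq0 _)) 3))
              hcA
        _ = coeffAbs α * M ^ 3 *
              ((((1 + ε₀) ^ (10 : ℝ)) ^ (n + L) * q ^ (n + L)) * (q ^ (n + L)) ^ 2) := by ring
        _ = δ L := by rw [hPL]; simp only [hδ]; ring
    linarith
  -- integrate: `Φ(u) = E_L(u) − ∫_{t₀}^u Π_n − δ_L u` is non-increasing on `[0,s]`
  have hEt : ∀ L : ℕ, E L t - E L t₀ ≤ (∫ u in t₀..t, botSum ε₀ α X n u) + δ L * (t - t₀) := by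
    intro L
    set Φ : ℝ → ℝ := fun u => E L u - (∫ x in t₀..u, botSum ε₀ α X n x) - δ L * u with hΦ
    have hderΦ : ∀ u ∈ Icc (0 : ℝ) s, HasDerivWithinAt Φ
        (D L u - botSum ε₀ α X n u - δ L) (Icc 0 s) u := by
      intro u hu
      have h1 := hderE L u hu
      have h2 := ((hPic.integral_hasStrictDerivAt t₀ u).hasDerivAt).hasDerivWithinAt
        (s := Icc (0 : ℝ) s)
      have h3 := ((hasDerivWithinAt_id u (Icc (0 : ℝ) s)).const_mul (δ L))
      have h4 := (h1.sub h2).sub h3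
      refine h4.congr_deriv ?_
      simp
    have hcontΦ : ContinuousOn Φ (Icc 0 s) := fun u hu => (hderΦ u hu).continuousWithinAt
    have hdiffΦ : DifferentiableOn ℝ Φ (interior (Icc 0 s)) := by
      intro u hu
      rw [interior_Icc] at hu
      exact ((hderΦ u ⟨hu.1.le, hu.2.le⟩).hasDerivAt
        (Icc_mem_nhds hu.1 hu.2)).differentiableAt.differentiableWithinAt
    have hle : ∀ u ∈ interior (Icc (0 : ℝ) s), deriv Φ u ≤ 0 := by
      intro u hu
      rw [interior_Icc] at hu
      rw [((hderΦ u ⟨hu.1.le, hu.2.le⟩).hasDerivAt (Icc_mem_nhds hu.1 hu.2)).deriv]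
      linarith [hDle L u]
    have h := (convex_Icc (0 : ℝ) s).image_sub_le_mul_sub_of_deriv_le hcontΦ hdiffΦ hle t₀
      ⟨ht₀, ht₀t.trans hts⟩ t ⟨ht₀.trans ht₀t, hts⟩ ht₀t
    simp only [hΦ, integral_same, zero_mul] at h
    rw [mul_sub]
    linarith
  -- pass to the limit `L → ∞`
  have hsum : ∀ u : ℝ, Summable fun j : ℕ =>
      ∑ i : Fin 4, (1 / 2 : ℝ) * X i (N + (j : ℤ)) u ^ 2 :=
    fun u => orthantBreak_summable hε hM (n + 1) u
  have hlim1 : Tendsto (fun L : ℕ => E L t - E L t₀) atTop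
      (𝓝 ((∑' j : ℕ, ∑ i : Fin 4, (1 / 2 : ℝ) * X i (N + (j : ℤ)) t ^ 2) -
        (∑' j : ℕ, ∑ i : Fin 4, (1 / 2 : ℝ) * X i (N + (j : ℤ)) t₀ ^ 2))) :=
    (hsum t).tendsto_sum_tsum_nat.sub (hsum t₀).tendsto_sum_tsum_nat
  have hlim2 : Tendsto (fun L : ℕ => (∫ u in t₀..t, botSum ε₀ α X n u) + δ L * (t - t₀)) atTop
      (𝓝 ((∫ u in t₀..t, botSum ε₀ α X n u) + 0 * (t - t₀))) := by
    refine tendsto_const_nhds.add (Tendsto.mul_const _ ?_)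
    have := (tendsto_pow_atTop_nhds_zero_of_lt_one (sq_nonneg q)
      (pow_lt_one₀ hq0 hq1 two_ne_zero)).const_mul (coeffAbs α * M ^ 3 * (q ^ 2) ^ n)
    simpa [hδ] using this
  have := le_of_tendsto_of_tendsto' hlim1 hlim2 hEt
  simpa using this

/-- **`TailFluxBudget` (layer-2 statement of the route plan).** For a cancelling table and a
regular `ν`-viscous solution on `[0,s]` issued from a one-shell datum at shell `0`, the tail
energy above shell `n ≥ 0` at time `t ∈ [0,s]` is at most the accumulated bond flux:
`T_{n+1}(t) ≤ ∫₀ᵗ Π_n(u) du` (the tail starts empty and is fed only through the bond `n → n+1`;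
dissipation dropped). [this file] -/
theorem orthantHop_tail_le_integral_flux {ε₀ ν s M : ℝ} (hε : 0 < ε₀) (hν : 0 < ν)
    {α : Fin 4 → Fin 4 → Fin 4 → ℤ × ℤ × ℤ → ℝ} (hc : IsCancellingCoeff α)
    {X₀ : Fin 4 → ℝ} {X : Fin 4 → ℤ → ℝ → ℝ}
    (hinit : ∀ (i : Fin 4) (k : ℤ), X i k 0 = if k = 0 then X₀ i else 0)
    (hM : ∀ (t : ℝ) (i : Fin 4) (k : ℤ), (1 + (1 + ε₀) ^ ((10 : ℝ) * k)) * |X i k t| ≤ M)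
    (hcont : ∀ (i : Fin 4) (k : ℤ), Continuous (X i k))
    (hder : ∀ (i : Fin 4) (k : ℤ), ∀ t ∈ Icc (0 : ℝ) s, HasDerivWithinAt (X i k)
      (quadTerm ε₀ α X i k t - ν * (1 + ε₀) ^ ((2 : ℝ) * k) * X i k t) (Icc (0 : ℝ) s) t)
    (n : ℕ) {t : ℝ} (ht : t ∈ Icc (0 : ℝ) s) :
    (∑' j : ℕ, ∑ i : Fin 4, (1 / 2 : ℝ) * X i ((n + 1 : ℕ) + (j : ℤ)) t ^ 2) ≤
      ∫ u in (0 : ℝ)..t, botSum ε₀ α X n u := by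
  have h := orthantHop_tailFluxBudget hε hν hc hM hcont hder n le_rfl ht.1 ht.2
  have hz : ∀ j : ℕ, ∑ i : Fin 4, (1 / 2 : ℝ) * X i ((n + 1 : ℕ) + (j : ℤ)) 0 ^ 2 = 0 :=
    fun j => Finset.sum_eq_zero fun i _ => by
      rw [hinit, if_neg (by push_cast; omega)]
      ring
  simp only [hz, tsum_zero, sub_zero] at h
  exact h

end Summit.NavierStokesRegularity.NavierStokesRegularity.Theorems

end
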